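import Mathlib

/-!
# STUB-IDEAS `stub_heegnerIndexLowerAtTwo` — k = 2, g27: **R178 EXECUTED (character audit `ρ` vs `ρ⁻¹`:
MATCH, no tower flip, one convention hazard located) + R176 ADVANCED (receptacle with DEFINED functionals)**

Crux item `stmt-BirchSwinnertonDyer-27851` (`PrintCf2.SplitBadTwoLowerHalfOfFacts`), stub
`stub_heegnerIndexLowerAtTwo` (class `49a1^{(d)}, 49a2^{(d)}`, `4 ∣ d_K`, CM by `K₀ = ℚ(√−7)`,
`2 = 𝔭𝔭̄` split, additive at 2; six dyadic keys).  Technique of this seat: literature transfer with a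
TYPED DICTIONARY (de Shalit I.3.4–3.5, Agboola 2007 §2/§9, Nekovář 8.4.2/8.4.4/8.4.8, BKNO 2026 (4.1)).

What is kernel-checked here (0 `sorry`, no instances, no notation):

§1  FINITE-LEVEL COVARIANCE of the two Riemann-sum conventions for `lam u := ∫ρ dμ_{log u}` on an
    abelian level group `G = Gal(T_n/ℚ₂)` with level data `c_u(σ) = log(σ u_n)` (so `c_{τu} = c_u(·τ)`):
    `naiveSum ρ c = Σ_σ ρ(σ)·c(σ)` is `ρ⁻¹`-COVARIANT (`naiveSum_translate`), whereas the de Shalit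
    normalisation `dsSum ρ c = Σ_σ ρ(σ⁻¹)·c(σ)` (= `∫ρ dμ_u` with `μ_{γu} = γ_*μ_u`, I.3.4 Lemma (ii),
    3.5 (ii)) is `ρ`-COVARIANT (`dsSum_translate`).  This is the ONE place a `ρ ↔ ρ⁻¹` slip can enter
    road RT⁺; it is a normalisation of `μ_{log u}`, not a choice of tower.
§2  AUDIT LEMMAS over k2-g25's `IsCharFunctional` / `CyclicUpToChar` (restated verbatim): a functional
    non-zero at one point has a UNIQUE semilinearity character (`semilinearChar_unique`); an
    out-of-range law `logTw = C·lam` with a non-zero value forces the two characters to agree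
    (`law_forces_char_eq`) — so a mismatch makes the package UNINHABITABLE (caught by B32), it never
    silently flips the tower; `proportional_of_cyclicUpToChar` re-proved.
§3  R176 ADVANCE: `AuditedPackage` — `lam := ev ∘ meas` and `logTw := logω ∘ sp` are DEFINED; their
    `χ_ρ`-semilinearity is a THEOREM (`lam_semi`, `logTw_semi`) from three print-shaped inputs:
    `meas` Λ-linear (de Shalit I.3.4 Cor.), `ev = ∫ρ d(·)` `χ_ρ`-semilinear (I.3.5 (ii)), `sp` =
    Kummer ∘ specialisation-at-ρ into the line `H = H¹(ℚ₂, ℤ₂(1) ⊗ ρ⁻¹) ⊗ ℚ` `χ_ρ`-semilinear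
    (Nekovář 8.4.4.1 / 8.4.8.1; BKNO 2026 (4.1): `g ↦ [g⁻¹]` on the Λ-factor, specialising at `χ`
    gives the `χ⁻¹`-twist); N1 stays in k2-g25's intrinsic coinvariant form `CyclicUpToChar χ_ρ u₀`;
    the uniform law `outOfRangeLogLaw` follows; `modelPackage` shows the receptacle is inhabited.
§4  CHARACTER BOOKKEEPING: Weil pairing `ψ_𝔭·ψ_𝔭̄ = ε` and `χ_d² = 1` give
    `ρ := (ψ_𝔭 ε⁻¹ χ_d)⁻¹ = ψ_𝔭̄ χ_d` (`rho_eq_conj_dir`): the character with `ℤ₂(1) ⊗ ρ⁻¹ = T_𝔭W|_{G_{ℚ₂}}`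
    IS the out-of-range `ψ* = ψ̄` direction of Rubin/Agboola (both sides `ψ*`: MATCH); and
    `ker ρ⁻¹ = ker ρ` (`ker_inv_eq`): same tower `T(key)`, NO flip.

BSD is NOT proved by any of this; nothing here touches the route's `closes`, the skeleton or its stubs.
-/

namespace Summit.BirchSwinnertonDyer.BirchSwinnertonDyer.Cruxes.SplitBadTwoLowerHalfOfFacts.CharacterAuditK2G27

/-! ## §1  Finite-level covariance of the two Riemann-sum conventions -/

section FiniteLevel

variable {G : Type*} [CommGroup G] {k : Type*} [CommRing k]

theorem map_inv_mul_map (ρ : G →* k) (σ : G) : ρ σ⁻¹ * ρ σ = 1 := by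
  rw [← map_mul, inv_mul_cancel, map_one]

theorem map_mul_map_inv (ρ : G →* k) (σ : G) : ρ σ * ρ σ⁻¹ = 1 := by
  rw [mul_comm, map_inv_mul_map]

variable [Fintype G]

/-- The NAIVE left-coset Riemann sum at level `n`: `Σ_σ ρ(σ) · c(σ)` with `c(σ) = log(σ u_n)`
(what `GroupDistribution.riemannSum` computes if one sets `μ_{log u} n (σU_n) := log(σ u_n)`). -/
def naiveSum (ρ : G →* k) (c : G → k) : k := ∑ σ, ρ σ * c σ

/-- The de Shalit-normalised sum `Σ_σ ρ(σ⁻¹) · c(σ)`: the level-`n` Riemann sum of `∫ρ dμ_u` for the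
measure with `μ_{γu}(γU) = μ_u(U)` [de Shalit I.3.4 Lemma (ii), p. 18]. -/
def dsSum (ρ : G →* k) (c : G → k) : k := ∑ σ, ρ σ⁻¹ * c σ

/-- **Hazard.** Replacing `u` by `τu` replaces the level data `c` by `σ ↦ c (σ * τ)`; the naive sum then
acquires the factor `ρ(τ)⁻¹ = ρ(τ⁻¹)`: the functional `u ↦ lim_n naiveSum ρ c_u` is `ρ⁻¹`-covariant. -/
theorem naiveSum_translate (ρ : G →* k) (c : G → k) (τ : G) :
    naiveSum ρ (fun σ => c (σ * τ)) = ρ τ⁻¹ * naiveSum ρ c := by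
  unfold naiveSum
  rw [Finset.mul_sum]
  conv_rhs => rw [← Equiv.sum_comp (Equiv.mulRight τ)]
  refine Finset.sum_congr rfl fun σ _ => ?_
  simp only [Equiv.coe_mulRight, map_mul]
  rw [show ρ τ⁻¹ * (ρ σ * ρ τ * c (σ * τ)) = (ρ τ⁻¹ * ρ τ) * (ρ σ * c (σ * τ)) by ring,
    map_inv_mul_map, one_mul]

/-- **De Shalit's normalisation is `ρ`-covariant** (I.3.5 (ii): `φ_k(γβ) = κ(γ)^k φ_k(β)`, p. 19). -/
theorem dsSum_translate (ρ : G →* k) (c : G → k) (τ : G) :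
    dsSum ρ (fun σ => c (σ * τ)) = ρ τ * dsSum ρ c := by
  unfold dsSum
  rw [Finset.mul_sum]
  conv_rhs => rw [← Equiv.sum_comp (Equiv.mulRight τ)]
  refine Finset.sum_congr rfl fun σ _ => ?_
  simp only [Equiv.coe_mulRight, mul_inv, map_mul]
  rw [show ρ τ * (ρ σ⁻¹ * ρ τ⁻¹ * c (σ * τ)) = (ρ τ * ρ τ⁻¹) * (ρ σ⁻¹ * c (σ * τ)) by ring,
    map_mul_map_inv, one_mul]

/-- The two conventions compute the SAME number for inverse characters: `dsSum ρ = naiveSum (ρ ∘ inv)`,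
i.e. `∫ρ dμ^{dS}_u = ∫ρ⁻¹ dμ^{naive}_u` — the one-symbol fix for R176's `lam`. -/
theorem dsSum_eq_naiveSum_inv (ρ : G →* k) (c : G → k) :
    dsSum ρ c = naiveSum (ρ.comp invMonoidHom) c := by
  simp [dsSum, naiveSum]

end FiniteLevel

/-! ## §2  Audit lemmas over the k2-g25 receptacle language -/

section Semilinear

variable {R : Type*} [CommRing R] {k : Type*} [Field k] {M : Type*} [AddCommGroup M] [Module R M]

/-- (verbatim from k2-g25 `MultOneK2G25.IsCharFunctional`) `f (r • m) = χ r * f m`. -/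
def IsCharFunctional (χ : R →+* k) (f : M →+ k) : Prop :=
  ∀ (r : R) (m : M), f (r • m) = χ r * f m

/-- (verbatim from k2-g25 `MultOneK2G25.CyclicUpToChar`) N1, multiplicity one in coinvariant form. -/
def CyclicUpToChar (χ : R →+* k) (m₀ : M) : Prop :=
  ∀ m : M, ∃ s r : R, χ s ≠ 0 ∧ s • m = r • m₀

/-- **Audit lemma A.** A functional that is non-zero at one point has a UNIQUE semilinearity character. -/
theorem semilinearChar_unique {χ χ' : R →+* k} {f : M →+ k} (h : IsCharFunctional χ f)
    (h' : IsCharFunctional χ' f) {m₀ : M} (h0 : f m₀ ≠ 0) : χ = χ' := by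
  ext r
  exact mul_right_cancel₀ h0 (by rw [← h r m₀, h' r m₀])

/-- A scalar multiple of a `χ`-functional is a `χ`-functional. -/
theorem IsCharFunctional.const_mul {χ : R →+* k} {g : M →+ k} (hg : IsCharFunctional χ g) (C : k)
    {f : M →+ k} (hlaw : ∀ m, f m = C * g m) : IsCharFunctional χ f := by
  intro r m
  rw [hlaw, hlaw, hg]
  ring

/-- **Audit lemma B (the verdict in mechanical form).** If the cohomology side `f = logTw` is
`χ`-semilinear and the measure side `g = lam` is `χ'`-semilinear, an out-of-range law `f = C·g` with ONE
non-zero value forces `χ = χ'`.  With the naive convention (`χ' = χ_{ρ⁻¹} ≠ χ_ρ`) no law exists at all: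
the receptacle is uninhabitable — the tower is never flipped. -/
theorem law_forces_char_eq {χ χ' : R →+* k} {f g : M →+ k} (hf : IsCharFunctional χ f)
    (hg : IsCharFunctional χ' g) {C : k} (hlaw : ∀ m, f m = C * g m) {m₀ : M} (h0 : f m₀ ≠ 0) :
    χ = χ' :=
  semilinearChar_unique hf (hg.const_mul C hlaw) h0

/-- k2-g25's `proportional_of_cyclicUpToChar`, re-proved: two `χ`-functionals on a module that is
cyclic up to `χ`-regular denominators are proportional as soon as one is non-zero on the generator. -/
theorem proportional_of_cyclicUpToChar {χ : R →+* k} {m₀ : M} (hcyc : CyclicUpToChar χ m₀)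
    {f g : M →+ k} (hf : IsCharFunctional χ f) (hg : IsCharFunctional χ g) (hg0 : g m₀ ≠ 0) :
    ∃ C : k, ∀ m, f m = C * g m := by
  refine ⟨f m₀ / g m₀, fun m => ?_⟩
  obtain ⟨s, r, hs, hsm⟩ := hcyc m
  have h1 : χ s * f m = χ r * f m₀ := by rw [← hf, hsm, hf]
  have h2 : χ s * g m = χ r * g m₀ := by rw [← hg, hsm, hg]
  have key : χ s * (f m * g m₀) = χ s * (f m₀ * g m) := by
    linear_combination (g m₀) * h1 - (f m₀) * h2
  rw [div_mul_eq_mul_div, eq_div_iff hg0]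
  exact mul_left_cancel₀ hs key

end Semilinear

/-! ## §3  R176 advanced: the receptacle with DEFINED functionals -/

section Receptacle

variable (R : Type*) [CommRing R] (k : Type*) [Field k] (M : Type*) [AddCommGroup M] [Module R M]
  (Λt : Type*) [AddCommGroup Λt] [Module R Λt] (H : Type*) [AddCommGroup H] [Module k H]

/-- The (2)₂ local package of ONE dyadic key with the two functionals DEFINED by composition.
`R = Λ(key) = ℤ₂⟦Gal(T(key)/ℚ₂)⟧`, `M = U_∞(T(key))` with the GEOMETRIC action (`γ·u = γ(u)`),
`Λt ⊇ Λ` the measure module (e.g. `𝒪_{ℂ₂}⟦𝒢⟧`), `H = H¹(ℚ₂, ℤ₂(1) ⊗ ρ⁻¹) ⊗ ℚ = H¹(ℚ₂, V_𝔭W)` (a line,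
`H¹_f = H¹`).  Inputs are print-shaped: `meas` (de Shalit I.3.4 Cor., Λ-linear), `ev_semi` (I.3.5 (ii)),
`sp_semi` (Nekovář 8.4.8.1 with the `⟨−1⟩` of 8.4.4.1 = BKNO 2026 (4.1)), N1 `cyc`, N2′ `lam_ne`. -/
structure AuditedPackage where
  /-- `χ_ρ : Λ(key) → k`, `[γ] ↦ ρ(γ)`, `ρ = ψ̄_A|_{G_{ℚ₂}} · sgn_d` (§4: the OUT-OF-RANGE direction) -/
  χ : R →+* k
  /-- `u ↦ μ_u`, Λ-LINEAR: `μ_{γu} = γ_* μ_u` (de Shalit I.3.4 Lemma (ii) + Corollary) -/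
  meas : M →ₗ[R] Λt
  /-- `μ ↦ ∫ρ dμ` -/
  ev : Λt →+ k
  /-- `∫ρ d([γ]μ) = ρ(γ) ∫ρ dμ` (I.3.5 (ii)); FALSE for the naive left-coset sum (§1 `naiveSum_translate`) -/
  ev_semi : ∀ (r : R) (μ : Λt), ev (r • μ) = χ r * ev μ
  /-- Kummer ∘ specialisation at `ρ`: `U_∞ → H¹_Iw(ℤ₂(1)) → H¹(ℚ₂, ℤ₂(1) ⊗ ρ⁻¹) ⊗ ℚ = H` -/
  sp : M →+ H
  /-- `sp` kills `([γ] − ρ(γ))·z`: `χ_ρ`-semilinear onto the coinvariant line of the `ρ⁻¹`-twist -/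
  sp_semi : ∀ (r : R) (m : M), sp (r • m) = χ r • sp m
  /-- Bloch–Kato `log_ω` on the line `H` (`H¹_f = H¹` for `V_𝔭W|_{G_{ℚ₂}}`) -/
  logω : H →ₗ[k] k
  /-- a test family of norm-coherent units -/
  u₀ : M
  /-- N2′: `∫ρ dμ_{u₀} ≠ 0` (finite certificate per key, R177) -/
  lam_ne : ev (meas u₀) ≠ 0
  /-- N1: multiplicity one at `ρ(key)` in the intrinsic coinvariant form (k2-g25) -/
  cyc : CyclicUpToChar χ u₀

namespace AuditedPackage

variable {R k M Λt H}
variable (P : AuditedPackage R k M Λt H)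

/-- measure-side functional, DEFINED: `lam := (∫ρ d·) ∘ (u ↦ μ_u)` -/
def lam : M →+ k := P.ev.comp P.meas.toAddMonoidHom

/-- cohomology-side functional, DEFINED: `logTw := log_ω ∘ sp_ρ` -/
def logTw : M →+ k := P.logω.toAddMonoidHom.comp P.sp

@[simp] theorem lam_apply (m : M) : P.lam m = P.ev (P.meas m) := rfl

@[simp] theorem logTw_apply (m : M) : P.logTw m = P.logω (P.sp m) := rfl

/-- **R176, measure side as a THEOREM**: `lam` is `χ_ρ`-semilinear. -/
theorem lam_semi : IsCharFunctional P.χ P.lam := by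
  intro r m
  rw [lam_apply, lam_apply, map_smul, P.ev_semi]

/-- **R176, cohomology side as a THEOREM**: `logTw` is `χ_ρ`-semilinear. -/
theorem logTw_semi : IsCharFunctional P.χ P.logTw := by
  intro r m
  rw [logTw_apply, logTw_apply, P.sp_semi, map_smul, smul_eq_mul]

theorem lam_ne' : P.lam P.u₀ ≠ 0 := P.lam_ne

/-- **The uniform out-of-range log law of the key** (k2-g25's `twistedKummerLogLaw_uniform`, now with
both functionals defined): ONE constant `C(key)` with `log_ω(sp_ρ u) = C(key) · ∫ρ dμ_u` on all of `U_∞`. -/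
theorem outOfRangeLogLaw : ∃ C : k, ∀ m : M, P.logTw m = C * P.lam m :=
  proportional_of_cyclicUpToChar P.cyc P.logTw_semi P.lam_semi P.lam_ne'

/-- The constant is non-zero as soon as `logTw u₀ ≠ 0` (e.g. `sp u₀ ≠ 0`, `log_ω` injective on the line). -/
theorem outOfRangeLogLaw_const_ne_zero (h : P.logTw P.u₀ ≠ 0) :
    ∃ C : k, C ≠ 0 ∧ ∀ m : M, P.logTw m = C * P.lam m := by
  obtain ⟨C, hC⟩ := P.outOfRangeLogLaw
  refine ⟨C, ?_, hC⟩
  rintro rfl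
  exact h (by rw [hC, zero_mul])

end AuditedPackage

/-- **Non-vacuity (B32 shape)**: the receptacle is inhabited (trivial model over `ℚ`). -/
def modelPackage : AuditedPackage ℚ ℚ ℚ ℚ ℚ where
  χ := RingHom.id ℚ
  meas := LinearMap.id
  ev := AddMonoidHom.id ℚ
  ev_semi := by intro r μ; simp
  sp := AddMonoidHom.id ℚ
  sp_semi := by intro r m; simp
  logω := LinearMap.id
  u₀ := 1
  lam_ne := by simp
  cyc := by
    intro m
    exact ⟨1, m, by simp, by simp⟩

example : ∃ C : ℚ, ∀ m : ℚ, modelPackage.logTw m = C * modelPackage.lam m :=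
  modelPackage.outOfRangeLogLaw

end Receptacle

/-! ## §4  Character bookkeeping: which `ρ`, and no tower flip -/

section Characters

variable {G : Type*} [Group G] {A : Type*} [CommGroup A]

/-- **Dictionary D4.** In the character group of `G_{ℚ₂}`: `a = ψ_𝔭`, `b = ψ_𝔭̄`, `e = ε` (Weil pairing:
`ψ_𝔭 ψ_𝔭̄ = ε`), `d = χ_d` quadratic.  `T_𝔭W = ℤ₂(ψ_𝔭 χ_d) = ℤ₂(1) ⊗ (ψ_𝔭 ε⁻¹ χ_d)`, so the character
`ρ` with `ℤ₂(1) ⊗ ρ⁻¹ = T_𝔭W` is `ρ = (ψ_𝔭 ε⁻¹ χ_d)⁻¹ = ψ_𝔭̄ χ_d`: the OUT-OF-RANGE (`ψ* = ψ̄`) direction,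
unramified-times-quadratic on `G_{ℚ₂}` — Rubin's / Agboola's `ψ*` on BOTH sides (R178: MATCH). -/
theorem rho_eq_conj_dir (a b e d : A) (hab : a * b = e) (hd : d * d = 1) :
    (a * e⁻¹ * d)⁻¹ = b * d := by
  subst hab
  have hd' : d⁻¹ = d := inv_eq_of_mul_eq_one_right hd
  simp only [mul_inv_rev, inv_inv]
  rw [mul_comm a b, mul_inv_cancel_right, hd', mul_comm]

/-- **No tower flip.** `ρ` and `ρ⁻¹` cut out the same tower: `ker ρ⁻¹ = ker ρ` (`T(key)` unchanged). -/
theorem ker_inv_eq (ρ : G →* A) : (ρ⁻¹).ker = ρ.ker := by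
  ext σ
  simp [MonoidHom.mem_ker]

end Characters

end Summit.BirchSwinnertonDyer.BirchSwinnertonDyer.Cruxes.SplitBadTwoLowerHalfOfFacts.CharacterAuditK2G27
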